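/-
Copyright (c) 2026. All rights reserved.
Released under Apache 2.0 license as described in the file LICENSE.
Authors: abc-iut cell, seat abc-iut-f-069 (gen 4; row «DPSC-NODAL-MODEL», complementary half to abc-iut-L4-t6 g7).
-/
import Literature.AnabelianGeometry.EtaleTheta.SettingModelKrullCuspCommTerminal
import Mathlib.GroupTheory.SemidirectProduct
import Mathlib.GroupTheory.QuotientGroup.Basic
import HarnessLib

/-!
# [AbsTopII] Def 1.2 (ii): decomposition groups `S ⋊ G` inside a semidirect product `N ⋊_φ G` (generic lemmas)

S. Mochizuki, *Topics in Absolute Anabelian Geometry II* [AbsTopII] (bib `MochizukiAbsTopII2013`; locators = PDF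
pages of the kurims manuscript `paper:url-585b8d0ad0d9`), §1 Def 1.2 (ii) p. 10 (`D_v := N_{Π_H}(Π_v)`,
`D_e := N_{Π_H}(Π_e)` inside the DPSC-extension `Π_H = Π_𝔾 ⋊^{out} H`), Prop 1.3 (vii)/(ix) p. 12; [SemiAnbd]
(`MochizukiSemiAnbd2006`) Thm 6.5 (ii) p. 71 (commensurable terminality of cusp decomposition groups `I_x ⋊ G`).

PROOF-ONLY (no definition), abc-iut-f-069 (gen 4), row «DPSC-NODAL-MODEL» (abc-iut-L4-t6 g7 / abc-iut-f-069):
the GENERIC group theory used at the nodal Dehn-twist model `Π_I = F̂₂ ⋊_{shear^i} Ẑ` (consumer: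
`AbsTopII/DehnTwistDecompositionGroups.lean`).  For any semidirect product `N ⋊_φ G` and any `φ`-STABLE subgroup
`S ≤ N`:
* `mem_map_inl_sup_range_inr_iff` — "`S ⋊ G`" `:= S.map inl ⊔ inr.range = {x | x.left ∈ S}`;
* `conj_inl_eq`, `conj_smul_map_inl` — conjugating `S × 1` by `x` is conjugating `S` by `x.left`;
* `mem_normalizer_map_inl_iff`, `mem_commensurator_map_inl_iff`, `mem_centralizer_map_inl_iff_of_fixed` —
  membership in `N(S × 1)`, `C(S × 1)`, `Z(S × 1)` is read on the left factor; hence `N(S × 1) = S ⋊ G` when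
  `N_N(S) = S` etc. (`normalizer_map_inl_eq_of_normalizer_eq`, `commensurator_…`, `centralizer_…`);
* `mem_of_commensurable_conj_smul_of_left_mem`, `isCommensurablyTerminal_map_inl_sup_range_inr` — abc-iut-L2-t5's
  C7d argument (`SettingModelKrullCuspCommTerminal` §2, there for the commutator axis of `Γ = F̂₂ ×_Ẑ ℤ`) made
  GENERIC: **`S ⋊ G` is commensurably terminal in `N ⋊_φ G` whenever `S` is commensurably terminal in `N`**
  (pull the commensurability back along `inl`; abc-iut-L2-t5's bookkeeping `commensurable_comap`, `comap_conj_smul`,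
  `mem_of_isCommensurablyTerminal` consumed BY NAME);
* `range_inr_le_normalizer_map_inl`, `map_mk'_eq_top_of_range_inr_le` — the section `1 ⋊ G` normalises `S × 1`,
  and any subgroup containing it maps ONTO `(N ⋊ G)/(N × 1)` ("the image of `D` in `H` is open").
HONEST FRAMING: classical group theory; nothing here bears on [IUTchIII] Cor 3.12; no side taken.
-/

noncomputable section

open scoped Pointwise

namespace Literature.AnabelianGeometry.AbsoluteAnabelian.AbsTopII.DehnTwist

open Literature.AnabelianGeometry.EtaleTheta.SettingModel
open Literature.AnabelianGeometry.AbsoluteAnabelian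
open Function

/-! ### `S ⋊ G` inside `N ⋊_φ G` -/

section Semidirect

variable {N G : Type*} [Group N] [Group G] {φ : G →* MulAut N}

/-- **`S ⋊ G = S.map inl ⊔ inr.range = {x | x.left ∈ S}`** for a `φ`-stable subgroup `S ≤ N`.
[cite: MochizukiAbsTopII2013, Def 1.2 (ii) p.10] -/
theorem mem_map_inl_sup_range_inr_iff {S : Subgroup N} (hS : ∀ (g : G) (s : N), s ∈ S → φ g s ∈ S)
    (x : N ⋊[φ] G) :
    x ∈ S.map (SemidirectProduct.inl : N →* N ⋊[φ] G) ⊔ (SemidirectProduct.inr : G →* N ⋊[φ] G).range ↔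
      x.left ∈ S := by
  let D : Subgroup (N ⋊[φ] G) :=
    { carrier := {x | x.left ∈ S}
      mul_mem' := fun {x y} hx hy => by
        simp only [Set.mem_setOf_eq, SemidirectProduct.mul_left]
        exact S.mul_mem hx (hS _ _ hy)
      one_mem' := by simp only [Set.mem_setOf_eq, SemidirectProduct.one_left]; exact S.one_mem
      inv_mem' := fun {x} hx => by
        simp only [Set.mem_setOf_eq, SemidirectProduct.inv_left]
        exact hS _ _ (S.inv_mem hx) }
  constructor
  · intro hx
    have hle : S.map (SemidirectProduct.inl : N →* N ⋊[φ] G) ⊔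
        (SemidirectProduct.inr : G →* N ⋊[φ] G).range ≤ D := by
      refine sup_le ?_ ?_
      · rintro _ ⟨s, hs, rfl⟩
        change (SemidirectProduct.inl s : N ⋊[φ] G).left ∈ S
        rwa [SemidirectProduct.left_inl]
      · rintro _ ⟨g, rfl⟩
        change (SemidirectProduct.inr g : N ⋊[φ] G).left ∈ S
        rw [SemidirectProduct.left_inr]
        exact S.one_mem
    exact hle hx
  · intro hx
    rw [← SemidirectProduct.inl_left_mul_inr_right x]
    exact Subgroup.mul_mem _ (Subgroup.mem_sup_left ⟨x.left, hx, rfl⟩) (Subgroup.mem_sup_right ⟨x.right, rfl⟩)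

/-- Conjugation of `inl s` in `N ⋊_φ G`: `x · (s,1) · x⁻¹ = (x.left · φ_{x.right}(s) · x.left⁻¹, 1)`.
[cite: MochizukiAbsTopII2013, Def 1.2 (ii) p.10] -/
theorem conj_inl_eq (x : N ⋊[φ] G) (s : N) :
    x * SemidirectProduct.inl s * x⁻¹ = SemidirectProduct.inl (x.left * φ x.right s * x.left⁻¹) := by
  conv_lhs => rw [← SemidirectProduct.inl_left_mul_inr_right x]
  rw [map_mul, map_mul, map_inv, SemidirectProduct.inl_aut, mul_inv_rev, ← map_inv]
  group

/-- **Conjugating `S × 1` by `x` is conjugating `S` by `x.left`** (for `φ`-stable `S`):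
`x · (S × 1) · x⁻¹ = (x.left · S · x.left⁻¹) × 1`. [cite: MochizukiAbsTopII2013, Def 1.2 (ii) p.10] -/
theorem conj_smul_map_inl {S : Subgroup N} (hS : ∀ (g : G) (s : N), s ∈ S → φ g s ∈ S) (x : N ⋊[φ] G) :
    MulAut.conj x • S.map (SemidirectProduct.inl : N →* N ⋊[φ] G) =
      (MulAut.conj x.left • S).map (SemidirectProduct.inl : N →* N ⋊[φ] G) := by
  ext y
  simp only [Subgroup.mem_smul_pointwise_iff_exists, Subgroup.mem_map, MulAut.smul_def, MulAut.conj_apply]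
  constructor
  · rintro ⟨_, ⟨s, hs, rfl⟩, rfl⟩
    exact ⟨x.left * φ x.right s * x.left⁻¹, ⟨φ x.right s, hS _ _ hs, rfl⟩, (conj_inl_eq x s).symm⟩
  · rintro ⟨_, ⟨t, ht, rfl⟩, rfl⟩
    refine ⟨SemidirectProduct.inl (φ x.right⁻¹ t), ⟨φ x.right⁻¹ t, hS _ _ ht, rfl⟩, ?_⟩
    rw [conj_inl_eq, ← MulAut.mul_apply, ← map_mul, mul_inv_cancel, map_one, MulAut.one_apply]

/-- **`x ∈ N(S × 1) ⇔ x.left ∈ N(S)`** (for `φ`-stable `S`). [cite: MochizukiAbsTopII2013, Def 1.2 (ii) p.10] -/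
theorem mem_normalizer_map_inl_iff {S : Subgroup N} (hS : ∀ (g : G) (s : N), s ∈ S → φ g s ∈ S)
    (x : N ⋊[φ] G) :
    x ∈ Subgroup.normalizer ((S.map (SemidirectProduct.inl : N →* N ⋊[φ] G) : Subgroup (N ⋊[φ] G)) :
        Set (N ⋊[φ] G)) ↔
      x.left ∈ Subgroup.normalizer (S : Set N) := by
  rw [← Subgroup.conjAct_pointwise_smul_iff, ← Subgroup.conjAct_pointwise_smul_iff,
    ← conj_smul_eq_toConjAct_smul, ← conj_smul_eq_toConjAct_smul, conj_smul_map_inl hS]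
  exact (Subgroup.map_injective SemidirectProduct.inl_injective).eq_iff

/-- **`x` commensurates `S × 1` iff `x.left` commensurates `S`** (for `φ`-stable `S`; `inl` is injective).
[cite: MochizukiAbsTopII2013, Def 1.2 (ii) p.10] -/
theorem commensurable_conj_map_inl_iff {S : Subgroup N} (hS : ∀ (g : G) (s : N), s ∈ S → φ g s ∈ S)
    (x : N ⋊[φ] G) :
    Subgroup.Commensurable (MulAut.conj x • S.map (SemidirectProduct.inl : N →* N ⋊[φ] G))
        (S.map (SemidirectProduct.inl : N →* N ⋊[φ] G)) ↔
      Subgroup.Commensurable (MulAut.conj x.left • S) S := by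
  rw [conj_smul_map_inl hS]
  constructor
  · intro h
    have h' := commensurable_comap (SemidirectProduct.inl : N →* N ⋊[φ] G) h
    rwa [Subgroup.comap_map_eq_self_of_injective SemidirectProduct.inl_injective,
      Subgroup.comap_map_eq_self_of_injective SemidirectProduct.inl_injective] at h'
  · exact commensurable_map_of_injective SemidirectProduct.inl_injective

/-- **`x ∈ C(S × 1) ⇔ x.left ∈ C(S)`** (commensurators; `φ`-stable `S`). [cite: MochizukiAbsTopII2013, Def 1.2 (ii) p.10] -/
theorem mem_commensurator_map_inl_iff {S : Subgroup N} (hS : ∀ (g : G) (s : N), s ∈ S → φ g s ∈ S)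
    (x : N ⋊[φ] G) :
    x ∈ Subgroup.Commensurable.commensurator (S.map (SemidirectProduct.inl : N →* N ⋊[φ] G)) ↔
      x.left ∈ Subgroup.Commensurable.commensurator S := by
  rw [Subgroup.Commensurable.commensurator_mem_iff, Subgroup.Commensurable.commensurator_mem_iff,
    ← conj_smul_eq_toConjAct_smul, ← conj_smul_eq_toConjAct_smul]
  exact commensurable_conj_map_inl_iff hS x

/-- **`x ∈ Z(S × 1) ⇔ x.left ∈ Z(S)`** when the action FIXES `S` POINTWISE (abc-iut-L4-t6's S3 lemma, restated
here for self-containedness of the (vii) package). [cite: MochizukiAbsTopII2013, Def 1.2 (ii) p.10] -/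
theorem mem_centralizer_map_inl_iff_of_fixed {S : Subgroup N} (hfix : ∀ (g : G) (s : N), s ∈ S → φ g s = s)
    (x : N ⋊[φ] G) :
    x ∈ Subgroup.centralizer ((S.map (SemidirectProduct.inl : N →* N ⋊[φ] G) : Subgroup (N ⋊[φ] G)) :
        Set (N ⋊[φ] G)) ↔
      x.left ∈ Subgroup.centralizer (S : Set N) := by
  rw [Subgroup.mem_centralizer_iff, Subgroup.mem_centralizer_iff]
  constructor
  · intro h s hs
    have h1 := congrArg SemidirectProduct.left (h (SemidirectProduct.inl s) ⟨s, hs, rfl⟩)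
    simp only [SemidirectProduct.mul_left, SemidirectProduct.left_inl, SemidirectProduct.right_inl, map_one,
      MulAut.one_apply] at h1
    rw [hfix x.right s hs] at h1
    exact h1
  · rintro h _ ⟨s, hs, rfl⟩
    refine SemidirectProduct.ext ?_ ?_
    · simp only [SemidirectProduct.mul_left, SemidirectProduct.left_inl, SemidirectProduct.right_inl, map_one,
        MulAut.one_apply]
      rw [hfix x.right s hs]
      exact h s hs
    · simp only [SemidirectProduct.mul_right, SemidirectProduct.right_inl, one_mul, mul_one]

/-- **C7d, generic** (abc-iut-L2-t5's `mem_of_commensurable_conj_smul_of_left_mem_cAxisGfp` with the axis replaced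
by ANY subgroup `S ≤ N` containing every element that commensurates it): for `D ≤ N ⋊_φ G` with `x ∈ D ⇔ x.left ∈ S`,
every element commensurating `D` lies in `D`. [cite: MochizukiSemiAnbd2006, Thm 6.5 (ii) p.71] -/
theorem mem_of_commensurable_conj_smul_of_left_mem {S : Subgroup N}
    (hSct : ∀ n : N, Subgroup.Commensurable (MulAut.conj n • S) S → n ∈ S)
    (D : Subgroup (N ⋊[φ] G)) (hD : ∀ x, x ∈ D ↔ x.left ∈ S) (x : N ⋊[φ] G)
    (hx : Subgroup.Commensurable (MulAut.conj x • D) D) : x ∈ D := by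
  have hinr : ∀ g : G, (SemidirectProduct.inr g : N ⋊[φ] G) ∈ D := fun g => by
    rw [hD, SemidirectProduct.left_inr]; exact S.one_mem
  have hsplit : x = SemidirectProduct.inl x.left * SemidirectProduct.inr x.right :=
    (SemidirectProduct.inl_left_mul_inr_right x).symm
  have hx' : Subgroup.Commensurable (MulAut.conj (SemidirectProduct.inl x.left : N ⋊[φ] G) • D) D := by
    have h := hx
    rw [hsplit, map_mul, mul_smul, Subgroup.conj_smul_eq_self_of_mem (hinr x.right)] at h
    exact h
  have hcomap : D.comap (SemidirectProduct.inl : N →* N ⋊[φ] G) = S := by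
    ext n; rw [Subgroup.mem_comap, hD, SemidirectProduct.left_inl]
  have hn : Subgroup.Commensurable (MulAut.conj x.left • S) S := by
    have h := commensurable_comap (SemidirectProduct.inl : N →* N ⋊[φ] G) hx'
    rwa [comap_conj_smul, hcomap] at h
  exact (hD x).mpr (hSct x.left hn)

/-- **`S ⋊ G` is commensurably terminal in `N ⋊_φ G` whenever `S` is commensurably terminal in `N`** (`φ`-stable `S`).
[cite: MochizukiSemiAnbd2006, Thm 6.5 (ii) p.71] -/
theorem isCommensurablyTerminal_map_inl_sup_range_inr {S : Subgroup N}
    (hS : ∀ (g : G) (s : N), s ∈ S → φ g s ∈ S) (hSct : IsCommensurablyTerminal S) :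
    IsCommensurablyTerminal
      (S.map (SemidirectProduct.inl : N →* N ⋊[φ] G) ⊔ (SemidirectProduct.inr : G →* N ⋊[φ] G).range) :=
  isCommensurablyTerminal_of_forall
    (mem_of_commensurable_conj_smul_of_left_mem (fun _ hn => mem_of_isCommensurablyTerminal hSct hn) _
      (mem_map_inl_sup_range_inr_iff hS))

/-- For a `φ`-stable `S` with `N_N(S) = S`: **`N(S × 1) = S ⋊ G`**. [cite: MochizukiAbsTopII2013, Prop 1.3 (vii) p.12] -/
theorem normalizer_map_inl_eq_of_normalizer_eq {S : Subgroup N} (hS : ∀ (g : G) (s : N), s ∈ S → φ g s ∈ S)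
    (hN : Subgroup.normalizer (S : Set N) = S) :
    Subgroup.normalizer ((S.map (SemidirectProduct.inl : N →* N ⋊[φ] G) : Subgroup (N ⋊[φ] G)) :
        Set (N ⋊[φ] G)) =
      S.map (SemidirectProduct.inl : N →* N ⋊[φ] G) ⊔ (SemidirectProduct.inr : G →* N ⋊[φ] G).range := by
  ext x
  rw [mem_normalizer_map_inl_iff hS, mem_map_inl_sup_range_inr_iff hS, hN]

/-- For a `φ`-stable `S` with `C_N(S) = S`: **`C(S × 1) = S ⋊ G`**. [cite: MochizukiAbsTopII2013, Prop 1.3 (vii) p.12] -/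
theorem commensurator_map_inl_eq_of_commensurator_eq {S : Subgroup N}
    (hS : ∀ (g : G) (s : N), s ∈ S → φ g s ∈ S) (hC : Subgroup.Commensurable.commensurator S = S) :
    Subgroup.Commensurable.commensurator (S.map (SemidirectProduct.inl : N →* N ⋊[φ] G)) =
      S.map (SemidirectProduct.inl : N →* N ⋊[φ] G) ⊔ (SemidirectProduct.inr : G →* N ⋊[φ] G).range := by
  ext x
  rw [mem_commensurator_map_inl_iff hS, mem_map_inl_sup_range_inr_iff hS, hC]

/-- For a POINTWISE-fixed `S` with `Z_N(S) = S`: **`Z(S × 1) = S ⋊ G`**. [cite: MochizukiAbsTopII2013, Prop 1.3 (ii) p.11] -/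
theorem centralizer_map_inl_eq_of_centralizer_eq {S : Subgroup N}
    (hfix : ∀ (g : G) (s : N), s ∈ S → φ g s = s) (hZ : Subgroup.centralizer (S : Set N) = S) :
    Subgroup.centralizer ((S.map (SemidirectProduct.inl : N →* N ⋊[φ] G) : Subgroup (N ⋊[φ] G)) :
        Set (N ⋊[φ] G)) =
      S.map (SemidirectProduct.inl : N →* N ⋊[φ] G) ⊔ (SemidirectProduct.inr : G →* N ⋊[φ] G).range := by
  have hS : ∀ (g : G) (s : N), s ∈ S → φ g s ∈ S := fun g s hs => by rw [hfix g s hs]; exact hs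
  ext x
  rw [mem_centralizer_map_inl_iff_of_fixed hfix, mem_map_inl_sup_range_inr_iff hS, hZ]

/-- `1 ⋊ G ≤ N(S × 1)` for every `φ`-stable `S` (the section normalises). [cite: MochizukiAbsTopII2013, Prop 1.3 (vi) p.12] -/
theorem range_inr_le_normalizer_map_inl {S : Subgroup N} (hS : ∀ (g : G) (s : N), s ∈ S → φ g s ∈ S) :
    (SemidirectProduct.inr : G →* N ⋊[φ] G).range ≤
      Subgroup.normalizer ((S.map (SemidirectProduct.inl : N →* N ⋊[φ] G) : Subgroup (N ⋊[φ] G)) :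
        Set (N ⋊[φ] G)) := by
  rintro _ ⟨g, rfl⟩
  rw [mem_normalizer_map_inl_iff hS, SemidirectProduct.left_inr]
  exact Subgroup.one_mem _

/-- **The image in `H = (N ⋊ G)/(N × 1)` of any subgroup containing the section `1 ⋊ G` is everything** (in
particular open). [cite: MochizukiAbsTopII2013, Prop 1.3 (ix) p.12] -/
theorem map_mk'_eq_top_of_range_inr_le
    [((SemidirectProduct.inl : N →* N ⋊[φ] G).range).Normal] {D : Subgroup (N ⋊[φ] G)}
    (hD : (SemidirectProduct.inr : G →* N ⋊[φ] G).range ≤ D) :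
    D.map (QuotientGroup.mk' (SemidirectProduct.inl : N →* N ⋊[φ] G).range) = ⊤ := by
  rw [eq_top_iff]
  rintro q -
  obtain ⟨x, rfl⟩ := QuotientGroup.mk'_surjective _ q
  refine ⟨SemidirectProduct.inr x.right, hD ⟨x.right, rfl⟩, ?_⟩
  rw [QuotientGroup.mk'_apply, QuotientGroup.mk'_apply, QuotientGroup.eq]
  refine ⟨(φ x.right⁻¹) x.left, ?_⟩
  refine SemidirectProduct.ext ?_ ?_
  · simp only [SemidirectProduct.left_inl, SemidirectProduct.mul_left, SemidirectProduct.inv_left,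
      SemidirectProduct.left_inr, SemidirectProduct.inv_right, SemidirectProduct.right_inr, inv_one, map_one,
      one_mul, map_inv]
  · simp only [SemidirectProduct.right_inl, SemidirectProduct.mul_right, SemidirectProduct.inv_right,
      SemidirectProduct.right_inr, inv_mul_cancel]

end Semidirect

end Literature.AnabelianGeometry.AbsoluteAnabelian.AbsTopII.DehnTwist

end
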